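import Summits.Ventures.HSemireg.WedgeHankelRecurrenceGaussNodesInterlace

/-!
# Venture HSemireg — **THE GAUSS–MARKOV NODES LIE IN THE CONVEX HULL OF EVERY OTHER POSITIVE REPRESENTATION**: if `Σ_{j ≤ t} μ_j v_j^p = Σ_{l<N} ν_l w_l^p` for `p ≤ 2t + 1` (`μ_j, ν_l > 0`,
# `v` strictly increasing, any number `N` of atoms `w_l`) then `min_l w_l ≤ v_0` and `v_t ≤ max_l w_l` — the zeros of the orthogonal polynomial lie in the interior hull of the support;
# elementary proof by the test polynomials `(X − v_0)∏_{j≥1}(X − v_j)²` and `∏_{j≥1}(X − v_j)²`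

HONEST FRAMING. Part of the Lean index of the computation cell `pub-hsemireg` (seat p10 gen 41, Sunday typer «UNIFORM-IN-n»).  Real polynomials and finite sums only (N262's quadrature identity);
no variety, no cohomology theory, no sheaf, no Ext group and no semiregularity map is constructed here; nothing here says that HC / HC_CM / HC_AV holds; no Literature fact (unproved `Prop`) is
declared or used.  Custodian versions as in `WedgeHankelSiegelIdeal` (1/3).
SOURCES (cited).  G. Szegő, *Orthogonal Polynomials*, Thm 3.3.1 («the zeros of the orthogonal polynomials `p_n(x)` … are real and distinct and are located in the interior of the interval
`[a, b]`» — the smallest interval containing the support); M. G. Krein, A. A. Nudel'man, *The Markov Moment Problem and Extremal Problems* (1977), Ch. III §2 (principal representations).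
PROOF TYPED HERE.  If every `w_l > v_0`, the test polynomial `F = (X − v_0)∏_{j ≥ 1}(X − v_j)²` (degree `2t + 1`) has `Σ_j μ_j F(v_j) = 0` and `Σ_l ν_l F(w_l) ≥ 0` termwise, so every
`∏_{j≥1}(w_l − v_j) = 0`; then `G = ∏_{j ≥ 1}(X − v_j)²` (degree `2t`) has `Σ_l ν_l G(w_l) = 0 < μ_0 G(v_0) = Σ_j μ_j G(v_j)`, contradicting the quadrature identity.  Symmetrically at the top.
DEDUP DISCLOSURE (`rg -n 'convex hull|nodes_le|le_nodes' Summits/Ventures/HSemireg`, 2026-09-02): N262 (interlacing for `N = t + 2`); nothing for arbitrary `N`.  The 2 names below: 0 hits tree-wide.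

WHAT IS IN THE TREE.  N262 `sum_mul_eval_eq_of_moments_eq`; Mathlib `Finset.sum_eq_zero_iff_of_nonneg`, `Fin.succAbove`, `Fin.prod_univ_succ`.
THIS FILE (namespace `Summit.Ventures.HSemireg.Wedge.HankelOuter` continued; CHAINED on N262; 0 definitions):
* §1029 **`exists_node_le_gaussNode_zero`** (`∃ l, w_l ≤ v_0`), **`exists_gaussNode_last_le_node`** (`∃ l, v_t ≤ w_l`).
CAVEATS.  Nothing Ext-side.  New names only.
-/

open Module Polynomial
open scoped Matrix Polynomial

namespace Summit.Ventures.HSemireg.Wedge.HankelOuter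

/-! ## §1029. The extreme Gauss nodes bound every positive representation -/

/-- **`min_l w_l ≤ v_0`**: the smallest node of the `(t+1)`-atomic (Gauss–Markov) representation is at least the smallest node of any positive representation of the same moments
`s_0, …, s_{2t+1}`. [Szegő Thm 3.3.1; Krein–Nudel'man III §2; this file, §1029] -/
theorem exists_node_le_gaussNode_zero {t N : ℕ} {μ v : Fin (t + 1) → ℝ} {ν w : Fin N → ℝ} (hμ : ∀ j, 0 < μ j) (hv : StrictMono v) (hν : ∀ l, 0 < ν l)
    (hmom : ∀ p, p ≤ 2 * t + 1 → ∑ j, μ j * v j ^ p = ∑ l, ν l * w l ^ p) : ∃ l, w l ≤ v 0 := by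
  classical
  by_contra hcon
  push Not at hcon
  -- `G = ∏_{j ≥ 1} (X − v_j)²`, `F = (X − v_0) · G`
  set G : ℝ[X] := ∏ j : Fin t, (Polynomial.X - C (v j.succ)) ^ 2 with hG
  have hGdeg : G.natDegree = 2 * t := by
    rw [hG, natDegree_prod _ _ fun j _ => pow_ne_zero _ (X_sub_C_ne_zero _)]
    simp only [natDegree_pow, natDegree_X_sub_C, mul_one, Finset.sum_const, Finset.card_univ, Fintype.card_fin, smul_eq_mul]
    ring
  have hGnonneg : ∀ y : ℝ, 0 ≤ G.eval y := fun y => by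
    rw [hG, eval_prod]; exact Finset.prod_nonneg fun j _ => by rw [eval_pow]; exact sq_nonneg _
  have hGsucc : ∀ j : Fin t, G.eval (v j.succ) = 0 := fun j => by
    rw [hG, eval_prod]; exact Finset.prod_eq_zero (Finset.mem_univ j) (by simp)
  have hmom' : ∀ p, p < 2 * t + 2 → ∑ j, μ j * v j ^ p = ∑ l, ν l * w l ^ p := fun p hp => hmom p (by omega)
  -- step 1: `F`
  have hF := sum_mul_eval_eq_of_moments_eq (F := (Polynomial.X - C (v 0)) * G) hmom'
    (by rw [natDegree_mul (X_sub_C_ne_zero _) (by rw [hG]; exact Finset.prod_ne_zero_iff.2 fun j _ => pow_ne_zero _ (X_sub_C_ne_zero _)), natDegree_X_sub_C, hGdeg]; omega)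
  have hFv : ∑ j, μ j * ((Polynomial.X - C (v 0)) * G).eval (v j) = 0 := by
    refine Finset.sum_eq_zero fun j _ => ?_
    rw [eval_mul, eval_sub, eval_X, eval_C]
    rcases Fin.eq_zero_or_eq_succ j with rfl | ⟨i, rfl⟩
    · rw [sub_self, zero_mul, mul_zero]
    · rw [hGsucc, mul_zero, mul_zero]
  rw [hFv] at hF
  -- all terms of the `w`-sum are `≥ 0`, hence all vanish: every `G(w_l) = 0`
  have hterm : ∀ l, 0 ≤ ν l * ((Polynomial.X - C (v 0)) * G).eval (w l) := fun l => by
    rw [eval_mul, eval_sub, eval_X, eval_C]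
    exact mul_nonneg (hν l).le (mul_nonneg (sub_pos.2 (hcon l)).le (hGnonneg _))
  have hzero := (Finset.sum_eq_zero_iff_of_nonneg fun l _ => hterm l).1 hF.symm
  have hGw : ∀ l, G.eval (w l) = 0 := fun l => by
    have h := hzero l (Finset.mem_univ l)
    rw [eval_mul, eval_sub, eval_X, eval_C] at h
    rcases mul_eq_zero.1 h with h | h
    · exact absurd h (hν l).ne'
    · rcases mul_eq_zero.1 h with h | h
      · exact absurd (sub_eq_zero.1 h) (hcon l).ne'
      · exact h
  -- step 2: `G` itself contradicts the quadrature identity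
  have hG2 := sum_mul_eval_eq_of_moments_eq (F := G) hmom' (by rw [hGdeg]; omega)
  have hGwsum : ∑ l, ν l * G.eval (w l) = 0 := Finset.sum_eq_zero fun l _ => by rw [hGw, mul_zero]
  have hGvsum : 0 < ∑ j, μ j * G.eval (v j) := by
    rw [Fin.sum_univ_succ]
    have h0 : 0 < μ 0 * G.eval (v 0) := by
      refine mul_pos (hμ 0) ?_
      rw [hG, eval_prod]
      refine Finset.prod_pos fun j _ => ?_
      rw [eval_pow, eval_sub, eval_X, eval_C]
      exact sq_pos_of_ne_zero (sub_ne_zero.2 (hv (Fin.succ_pos j)).ne)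
    have hrest : ∑ i : Fin t, μ i.succ * G.eval (v i.succ) = 0 := Finset.sum_eq_zero fun i _ => by rw [hGsucc, mul_zero]
    rw [hrest, add_zero]
    exact h0
  rw [hG2, hGwsum] at hGvsum
  exact lt_irrefl _ hGvsum

/-- **`v_t ≤ max_l w_l`**: the largest Gauss–Markov node is at most the largest node of any positive representation of the same moments. [Szegő Thm 3.3.1; this file, §1029] -/
theorem exists_gaussNode_last_le_node {t N : ℕ} {μ v : Fin (t + 1) → ℝ} {ν w : Fin N → ℝ} (hμ : ∀ j, 0 < μ j) (hv : StrictMono v) (hν : ∀ l, 0 < ν l)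
    (hmom : ∀ p, p ≤ 2 * t + 1 → ∑ j, μ j * v j ^ p = ∑ l, ν l * w l ^ p) : ∃ l, v (Fin.last t) ≤ w l := by
  classical
  by_contra hcon
  push Not at hcon
  set G : ℝ[X] := ∏ j : Fin t, (Polynomial.X - C (v j.castSucc)) ^ 2 with hG
  have hGdeg : G.natDegree = 2 * t := by
    rw [hG, natDegree_prod _ _ fun j _ => pow_ne_zero _ (X_sub_C_ne_zero _)]
    simp only [natDegree_pow, natDegree_X_sub_C, mul_one, Finset.sum_const, Finset.card_univ, Fintype.card_fin, smul_eq_mul]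
    ring
  have hGnonneg : ∀ y : ℝ, 0 ≤ G.eval y := fun y => by
    rw [hG, eval_prod]; exact Finset.prod_nonneg fun j _ => by rw [eval_pow]; exact sq_nonneg _
  have hGcs : ∀ j : Fin t, G.eval (v j.castSucc) = 0 := fun j => by
    rw [hG, eval_prod]; exact Finset.prod_eq_zero (Finset.mem_univ j) (by simp)
  have hmom' : ∀ p, p < 2 * t + 2 → ∑ j, μ j * v j ^ p = ∑ l, ν l * w l ^ p := fun p hp => hmom p (by omega)
  have hF := sum_mul_eval_eq_of_moments_eq (F := (C (v (Fin.last t)) - Polynomial.X) * G) hmom'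
    (by rw [natDegree_mul (by rw [sub_ne_zero]; exact fun h => by simpa using congrArg natDegree h) (by rw [hG]; exact Finset.prod_ne_zero_iff.2 fun j _ => pow_ne_zero _ (X_sub_C_ne_zero _)), hGdeg,
      show (C (v (Fin.last t)) - Polynomial.X : ℝ[X]).natDegree = 1 by rw [natDegree_sub_eq_right_of_natDegree_lt] <;> simp]; omega)
  have hFv : ∑ j, μ j * ((C (v (Fin.last t)) - Polynomial.X) * G).eval (v j) = 0 := by
    refine Finset.sum_eq_zero fun j _ => ?_
    rw [eval_mul, eval_sub, eval_X, eval_C]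
    rcases Fin.eq_castSucc_or_eq_last j with ⟨i, rfl⟩ | rfl
    · rw [hGcs, mul_zero, mul_zero]
    · rw [sub_self, zero_mul, mul_zero]
  rw [hFv] at hF
  have hterm : ∀ l, 0 ≤ ν l * ((C (v (Fin.last t)) - Polynomial.X) * G).eval (w l) := fun l => by
    rw [eval_mul, eval_sub, eval_X, eval_C]
    exact mul_nonneg (hν l).le (mul_nonneg (sub_pos.2 (hcon l)).le (hGnonneg _))
  have hzero := (Finset.sum_eq_zero_iff_of_nonneg fun l _ => hterm l).1 hF.symm
  have hGw : ∀ l, G.eval (w l) = 0 := fun l => by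
    have h := hzero l (Finset.mem_univ l)
    rw [eval_mul, eval_sub, eval_X, eval_C] at h
    rcases mul_eq_zero.1 h with h | h
    · exact absurd h (hν l).ne'
    · rcases mul_eq_zero.1 h with h | h
      · exact absurd (sub_eq_zero.1 h) (hcon l).ne'
      · exact h
  have hG2 := sum_mul_eval_eq_of_moments_eq (F := G) hmom' (by rw [hGdeg]; omega)
  have hGwsum : ∑ l, ν l * G.eval (w l) = 0 := Finset.sum_eq_zero fun l _ => by rw [hGw, mul_zero]
  have hGvsum : 0 < ∑ j, μ j * G.eval (v j) := by
    rw [Fin.sum_univ_castSucc]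
    have hlast : 0 < μ (Fin.last t) * G.eval (v (Fin.last t)) := by
      refine mul_pos (hμ _) ?_
      rw [hG, eval_prod]
      refine Finset.prod_pos fun j _ => ?_
      rw [eval_pow, eval_sub, eval_X, eval_C]
      exact sq_pos_of_ne_zero (sub_ne_zero.2 (hv (Fin.castSucc_lt_last j)).ne')
    have hrest : ∑ i : Fin t, μ i.castSucc * G.eval (v i.castSucc) = 0 := Finset.sum_eq_zero fun i _ => by rw [hGcs, mul_zero]
    rw [hrest, zero_add]
    exact hlast
  rw [hG2, hGwsum] at hGvsum
  exact lt_irrefl _ hGvsum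

end Summit.Ventures.HSemireg.Wedge.HankelOuter
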